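import Summits.BirchSwinnertonDyer.Rank1Residual.AdditivePotMult.QuadraticBaseChangeDescentPrimeDiscriminant
import Summits.BirchSwinnertonDyer.Rank1Residual.AdditivePotMult.PStarTwistModel
import HarnessLib

/-!
# The canonical field has `d_K = p*`, so the twist is MULTIPLICATIVE at `p`: the class theorems of the
# base-change-and-descend route without the `Mult Wd p` binder (row T-MIL-3, FILE H-5d; seat
# n1011-p01 GEN 8)

HONEST FRAMING (cell `b2b-bsdres`, run/shared/lean/b2b/bsd-rank1-residual/, verbatim in every
file): the goal of the cell is to DELETE the COMBINATION-SHAPED residual classes of the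
Birch–Swinnerton-Dyer formula for ALL analytic-rank `≤ 1` elliptic curves over `ℚ` — "full BSD
formula for every rank `≤ 1` curve in class `C`" assembled STRICTLY from published theorems — so
that the rank-`≤ 1` remainder becomes exactly the CONSTRUCTION-SHAPED classes, which are TYPED
(missing-input `Prop`s), NOT attempted. This is not "finishing BSD". Sub-classes X3♯(M) / X4(M)
(additive, potentially multiplicative prime; base-change-and-descend): a RESEARCH ROUTE; they stay
CONSTRUCTION-SHAPED; nothing is booked by this file; no mark / label moved. THEOREMS ONLY: no
definition, no named fact, no `sorry`.

## What

FILE H-5c (`QuadraticBaseChangeDescentPrimeDiscriminant`) removed every LOCAL hypothesis from the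
descent END for the canonical field `|d_K| = p`, keeping the binder `Mult Wd p` (the twist
`W_d = C_d • W^{(d_K)}` is multiplicative at `p`). For a quadratic field, `|d_K| = p` odd forces
`d_K = p* = (−1)^{(p−1)/2} p` (Stickelberger: `d_K ≡ 1 (mod 4)`), and seat additive-p1's
`PStarTwistModel` proved `PotMult W p ⟹ Mult (W^{(p*)}) p` (Silverman *ATAEC* V.5.3: the additive
potentially multiplicative curve becomes multiplicative after the ramified quadratic twist). So the
binder is DISCHARGED from the class predicate itself:

* `discr_eq_pStar_of_natAbs_discr` — `[K:ℚ] = 2 ∧ |d_K| = p odd ⟹ (d_K : ℚ) = (−1)^{p/2} · p`;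
* `mult_twist_of_potMult_of_natAbs_discr` — `PotMult W p ⟹ Mult Wd p` for `Wd = C_d • W^{(d_K)}`;
* `bsdp_of_pPartOver_of_bsdp_twist_quadratic_of_unramifiedFact_of_natAbs_discr_of_potMult` — the
  END with `PotMult W p` in place of `Mult Wd p`;
* **`bsdp_of_classX4M_of_rankZero_twist_noMilne_of_unramifiedFact_canonical`** — for
  `(E,p) ∈ X4(M)`, `K` with `|d_K| = p`, `Wd = C_d • W^{(d_K)}` globally minimal of analytic rank `0`
  with (ram), `W' = C' • W_K` globally minimal: **`BSD(E,p) ⇐ MissingPPartOverAt W' p`** with inputs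
  {Skinner 2016 Thm. C, GZK, modularity, A233 (`hA`)} — the per-pair bits left are ONLY the twist's
  analytic rank `0` and (ram);
* `bsdp_of_classX3M_of_rankZero_twist_noMilne_of_unramifiedFact_canonical` — X3♯(M)⁰ likewise (`⇐
  MissingPPartOverAt W' p ∧ MissingLowerBoundAt Wd p`).

HONEST LIMITS: CONDITIONAL on A233 (`hA`; a theorem once row T-A233 U-3 lands); `|d_K| = p` only;
total analytic rank `≤ 1`; twist of analytic rank `0` and (ram) remain hypotheses (census bits, not
theorems); X3♯(M)/X4(M) stay CONSTRUCTION-SHAPED; TOOL/END theorems; closes no class; moves no mark.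

References: J. H. Silverman, *ATAEC* V.5.3 [SilvermanATAEC1994], *AEC* VII.5.4 (a), X.5 Cor. 5.4
[SilvermanAEC2009]; J. S. Milne, Invent. Math. 17 (1972) [Milne1972ArithmeticAV]; C. Skinner,
Pacific J. Math. 283 (2016) Thm. C [Skinner2016PacificMC]; C. Wuthrich, Doc. Math. 19 (2014)
Prop. 21 [Wuthrich2014]; R. L. Miller, LMS J. Comput. Math. 14 (2011) Def. 1.1 [Miller2011LMS].
-/

noncomputable section

open scoped Classical NumberField

open WeierstrassCurve NumberField NumberField.InfinitePlace IsDedekindDomain Rat.HeightOneSpectrum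
  Literature.NumberTheory.EllipticCurves Literature.NumberTheory.EllipticCurves.Rank1Residual
  Literature.NumberTheory.EllipticCurves.Rank1Residual.Typed
  Literature.NumberTheory.EllipticCurves.Wuthrich2014
  Literature.NumberTheory.DiophantineGeometry

namespace Summit.BirchSwinnertonDyer.Rank1Residual.AdditivePotMult

section CanonicalTwist

variable (W : WeierstrassCurve ℚ) [W.IsElliptic] [W.IsGloballyMinimal] (p : ℕ) [hp : Fact p.Prime]
  (K : Type) [Field K] [NumberField K]
  (Wd : WeierstrassCurve ℚ) [Wd.IsElliptic] [Wd.IsGloballyMinimal]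
  (W' : WeierstrassCurve K) [W'.IsElliptic] [W'.IsGloballyMinimal]

omit [hp : Fact p.Prime] in
/-- **`|d_K| = p` odd ⟹ `d_K = p* = (−1)^{p/2} · p`** for a quadratic field: `d_K = ±p` and
Stickelberger's `d_K ≡ 0, 1 (mod 4)` (tree `Quadratic.discr_emod_four`; `d_K` is odd, so `≡ 1`)
picks the sign `(−1)^{(p−1)/2}`. [folklore] -/
theorem discr_eq_pStar_of_natAbs_discr (h2 : Module.finrank ℚ K = 2) (hpr : p.Prime)
    (hdK : (NumberField.discr K).natAbs = p) (hp2 : p ≠ 2) :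
    (NumberField.discr K : ℚ) = (-1 : ℚ) ^ (p / 2) * p := by
  obtain ⟨k, hk⟩ := hpr.odd_of_ne_two hp2
  have hd : NumberField.discr K = p ∨ NumberField.discr K = -(p : ℤ) := Int.natAbs_eq_iff.mp hdK
  have h4 : NumberField.discr K % 4 = 0 ∨ NumberField.discr K % 4 = 1 :=
    Literature.NumberTheory.QuadraticFields.Quadratic.discr_emod_four h2
  have hp2' : (p : ℤ) = 2 * k + 1 := by exact_mod_cast hk
  have hdiv : p / 2 = k := by omega
  rw [hdiv]
  rcases Nat.even_or_odd k with he | ho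
  · rw [he.neg_one_pow, one_mul]
    obtain ⟨j, hj⟩ := he
    have : NumberField.discr K = p := by
      rcases hd with h | h
      · exact h
      · exfalso; rcases h4 with h4 | h4 <;> omega
    exact_mod_cast this
  · rw [ho.neg_one_pow, neg_one_mul]
    obtain ⟨j, hj⟩ := ho
    have : NumberField.discr K = -(p : ℤ) := by
      rcases hd with h | h
      · exfalso; rcases h4 with h4 | h4 <;> omega
      · exact h
    exact_mod_cast this

omit [W.IsGloballyMinimal] [Wd.IsElliptic] [Wd.IsGloballyMinimal] in
/-- **The twist by `d_K` of a potentially multiplicative curve is MULTIPLICATIVE at `p` when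
`|d_K| = p`**: `d_K = p*` (previous lemma) and `PotMult W p ⟹ Mult (W^{(p*)}) p` (seat
additive-p1's `PotMult.mult_quadraticTwist_pStar`, Silverman *ATAEC* V.5.3), transported to the
model `Wd = C_d • W^{(d_K)}` (`hasMultiplicativeReductionAtPrime_smul_iff`).
[cite: SilvermanATAEC1994, V.5.3] [cite: SilvermanAEC2009, VII.5 Prop. 5.1(b), X.5 Cor. 5.4] -/
theorem mult_twist_of_potMult_of_natAbs_discr (hpm : PotMult W p) (hp2 : p ≠ 2)
    (h2 : Module.finrank ℚ K = 2) (hdK : (NumberField.discr K).natAbs = p)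
    {Cd : VariableChange ℚ} (hWd : Cd • W.quadraticTwist (NumberField.discr K : ℚ) = Wd) :
    Mult Wd p := by
  have hps : (NumberField.discr K : ℚ) = (-1 : ℚ) ^ (p / 2) * p :=
    discr_eq_pStar_of_natAbs_discr p K h2 hp.out hdK hp2
  have hps0 : ((-1 : ℚ) ^ (p / 2) * p) ≠ 0 :=
    mul_ne_zero (pow_ne_zero _ (neg_ne_zero.mpr one_ne_zero)) (by exact_mod_cast hp.out.ne_zero)
  haveI := W.isElliptic_quadraticTwist hps0
  have hm : Mult (W.quadraticTwist ((-1 : ℚ) ^ (p / 2) * p)) p := hpm.mult_quadraticTwist_pStar hp2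
  have hWd' : Cd • W.quadraticTwist ((-1 : ℚ) ^ (p / 2) * p) = Wd := by rw [← hps]; exact hWd
  rw [← hWd']
  exact (hasMultiplicativeReductionAtPrime_smul_iff _ Cd p).mpr hm

/-- **THE END FOR THE CANONICAL FIELD with `Mult Wd p` DISCHARGED from `PotMult W p`**: `W/ℚ`
globally minimal, additive potentially multiplicative at the odd prime `p`, `[K:ℚ] = 2` with
`|d_K| = p`, `Wd = C_d • W^{(d_K)}` and `W' = C' • W_K` globally minimal, `r_an(W) + r_an(Wd) ≤ 1`,
`hA` = A233 for `W`: `BSDp W p ⟸ MissingPPartOverAt W' p ∧ BSDp Wd p` (`hGZK`, `hmod`).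
[cite: Milne1972ArithmeticAV, §1 Thm. 1 and §2 (through DokchitserDokchitserAnnals2010, §2.1, proof of Thm. 8)]
[cite: SilvermanATAEC1994, V.5.3] [cite: SilvermanAEC2009, Prop. VII.5.4 (a)] -/
theorem bsdp_of_pPartOver_of_bsdp_twist_quadratic_of_unramifiedFact_of_natAbs_discr_of_potMult
    (hGZK : rank_eq_analyticRank_of_analyticRank_le_one) (hmod : hasEntireLFunction_rat)
    (h2 : Module.finrank ℚ K = 2) (hdK : (NumberField.discr K).natAbs = p)
    {Cd : VariableChange ℚ} (hWd : Cd • W.quadraticTwist (NumberField.discr K : ℚ) = Wd)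
    {C' : VariableChange K} (hW' : C' • W.baseChange K = W')
    (hr : W.analyticRank + Wd.analyticRank ≤ 1)
    (hA : ∀ (v : HeightOneSpectrum (𝓞 ℚ)) (w : HeightOneSpectrum (𝓞 K)),
      kodairaSymbolAt_baseChange_of_ramificationIdx_eq_one K v w W)
    (hp2 : p ≠ 2) (hpm : PotMult W p)
    (hK : MissingPPartOverAt W' p) (hd : BSDp Wd p) : BSDp W p :=
  bsdp_of_pPartOver_of_bsdp_twist_quadratic_of_unramifiedFact_of_natAbs_discr W p K Wd W' hGZK hmod h2
    hdK hWd hW' hr hA hp2 (mult_twist_of_potMult_of_natAbs_discr W p K Wd hpm hp2 h2 hdK hWd) hK hd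

/-- **X4(M)⁰ WITH THE CANONICAL FIELD, `Mult Wd p` DISCHARGED: `BSD(E, p) ⇐ MissingPPartOverAt W' p`.**
For `(E,p) ∈ X4(M)` (odd additive `p`, `E[p]` irreducible, `ord_p j < 0`) of analytic rank `≤ 1`, the
quadratic field `K` with `|d_K| = p` (so `d_K = p*`), `Wd = C_d • W^{(d_K)}` globally minimal of
analytic rank `0` with (ram), `W' = C' • W_K` globally minimal, and A233 as `hA`: inputs {Skinner
2016 Thm. C (`hSk` — the twist is multiplicative at `p` by `mult_twist_of_potMult_of_natAbs_discr`,
so COVERED), `hGZK`, `hmod`, `hA`}. The per-pair hypotheses left are EXACTLY the twist's analytic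
rank `0` and (ram); the residue is the typed `MissingPPartOverAt W' p`.
[cite: Skinner2016PacificMC, Thm. C (§1), footnote 1, §2.5] [cite: SilvermanATAEC1994, V.5.3]
[cite: Milne1972ArithmeticAV, §1 Thm. 1 and §2 (through DokchitserDokchitserAnnals2010, §2.1, proof of Thm. 8)] -/
theorem bsdp_of_classX4M_of_rankZero_twist_noMilne_of_unramifiedFact_canonical
    (hGZK : rank_eq_analyticRank_of_analyticRank_le_one) (hmod : hasEntireLFunction_rat)
    (hSk : Skinner2016.thmC_padicValRat_bsd_rank_zero)
    (hX : ClassX4M W p) (hr : W.analyticRank ≤ 1) (h2 : Module.finrank ℚ K = 2)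
    (hdK : (NumberField.discr K).natAbs = p)
    {Cd : VariableChange ℚ} (hWd : Cd • W.quadraticTwist (NumberField.discr K : ℚ) = Wd)
    (hram : Ram Wd p) (hr0 : Wd.analyticRank = 0)
    {C' : VariableChange K} (hW' : C' • W.baseChange K = W')
    (hA : ∀ (v : HeightOneSpectrum (𝓞 ℚ)) (w : HeightOneSpectrum (𝓞 K)),
      kodairaSymbolAt_baseChange_of_ramificationIdx_eq_one K v w W)
    (hK : MissingPPartOverAt W' p) : BSDp W p :=
  bsdp_of_classX4M_of_rankZero_twist_noMilne_of_unramifiedFact_of_natAbs_discr W p K Wd W' hGZK hmod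
    hSk hX hr h2 hdK hWd
    (mult_twist_of_potMult_of_natAbs_discr W p K Wd (ClassX4M.potMult W p hX) hX.p_ne_two h2 hdK hWd)
    hram hr0 hW' hA hK

/-- **X3♯(M)⁰ WITH THE CANONICAL FIELD, `Mult Wd p` DISCHARGED:
`BSD(E,p) ⇐ MissingPPartOverAt W' p ∧ MissingLowerBoundAt Wd p`** (inputs Wuthrich 2014 Prop. 21
`hW`, `hGZK`, `hmod`, `hA`; per-pair hypothesis left: the twist's analytic rank `0`).
[cite: Wuthrich2014, Prop. 21] [cite: SilvermanATAEC1994, V.5.3]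
[cite: Milne1972ArithmeticAV, §1 Thm. 1 and §2 (through DokchitserDokchitserAnnals2010, §2.1, proof of Thm. 8)] -/
theorem bsdp_of_classX3M_of_rankZero_twist_noMilne_of_unramifiedFact_canonical
    (hGZK : rank_eq_analyticRank_of_analyticRank_le_one) (hmod : hasEntireLFunction_rat)
    (hW : sha_dvd_analyticSha)
    (hX : ClassX3M W p) (hr : W.analyticRank ≤ 1) (h2 : Module.finrank ℚ K = 2)
    (hdK : (NumberField.discr K).natAbs = p)
    {Cd : VariableChange ℚ} (hWd : Cd • W.quadraticTwist (NumberField.discr K : ℚ) = Wd)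
    (hr0 : Wd.analyticRank = 0)
    {C' : VariableChange K} (hW' : C' • W.baseChange K = W')
    (hA : ∀ (v : HeightOneSpectrum (𝓞 ℚ)) (w : HeightOneSpectrum (𝓞 K)),
      kodairaSymbolAt_baseChange_of_ramificationIdx_eq_one K v w W)
    (hK : MissingPPartOverAt W' p) (hlow : MissingLowerBoundAt Wd p) : BSDp W p :=
  bsdp_of_classX3M_of_rankZero_twist_noMilne_of_unramifiedFact_of_natAbs_discr W p K Wd W' hGZK hmod
    hW hX hr h2 hdK hWd
    (mult_twist_of_potMult_of_natAbs_discr W p K Wd (ClassX3M.potMult W p hX) (ClassX3M.p_ne_two W p hX)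
      h2 hdK hWd)
    hr0 hW' hA hK hlow

end CanonicalTwist

end Summit.BirchSwinnertonDyer.Rank1Residual.AdditivePotMult

end
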